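import Summits.QuantumFields.BalabanUV.Beta.GAN24.KernelPeriodisation
import Summits.QuantumFields.BalabanUV.Beta.HessKerDressedUnits
import Literature.MathematicalPhysics.QuantumFieldTheory.Balaban1983to89.Beta.HessKerSchurResolvent

/-!
# `BalabanUV.Beta.FP.KernelPeriodisationFib` — road «FP» (binder row D1), design «ROUTE T — PERIODISE ∕ FACTORISE ∕ DE-PERIODISE AT FINITE j»
# (owner d1-p3 g16, RULING R-FP-51, HOME/CLAIMS.log [D1P3-G16-RFP51]), row **(T-PER) FOR THE PACKED FIBRE KERNELS**, PART 1 of 2: periodisation of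
# `ExpKernelCalculus.MKer (d+1) F` kernels (generic finite fibre `F`; the road's `Fib d` is an instance) onto the matrices of the torus box is an ALGEBRA
# HOMOMORPHISM on invariant kernels, linear, and commutes with diagonal fibre scalings (the wall's units maps)

Supplier: road-P3 lineage `b2b-balaban-gan24-p3` (gen 31).  SPEC = gan24-formalise-leaf-06 g41's word W-leaf06-g41-3 (HOME/CLAIMS.log l.35858, items (1)–(6)),
credited: the dictionary `toK` to PART A and «`dec` ∕ `unitK` commute with `per` exactly» are that word's; PART A (`GAN24/KernelPeriodisation`: `per`, `per_comp`,
`per_delta`, `per_trK`) is leaf-06 g40's p298128; the `scaleK` shape of §4 is asym1's W-asym1-g94-1.  NOT IN PRINT; OUR BOOKKEEPING ([folklore] re-indexing of absolutely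
convergent period sums).  No `Prop` is minted, nothing is cited, no hypothesis quotes a printed statement; the new `def`s are the bookkeeping maps `perZ`, `perF`,
`toK`, `idxMap`, `trF` (+ the index abbreviation `Idx`).
CONTENT (every `d`, finite fibre `F`, period vector `M`).  §1 `perZ M K x y a b = Σ'_m K x (y + M∘m) a b` (the periodised kernel AS A KERNEL; right-periodic, two-sided
periodic for `Mℤ^{d+1}`-invariant `K`), its box restriction `perF M K : Matrix (↥(pbox M) × F) (↥(pbox M) × F) ℝ`, summability of the period sums of a decaying kernel.
§2 DICTIONARY to PART A: `perF_eq_submatrix : perF M K = (per M (toK e K)).submatrix (idxMap e M) (idxMap e M)`, `toK_comp` (Fubini on `sites × Fin n` under `Decays`),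
transfer of decay (`ℓ¹ ≥ sup`) and invariance.  §3 **`perF_comp`** (`Decays A`, `Decays B`, positive rates, `B` invariant ⇒ `perF M (A ∘ B) = perF M A * perF M B`), `perF_idK`
(`= 1`), `perF_transpose` (NO inverse item: by R-FP-51 the road's packed resolvents have no two-sided kernel inverse on `ℤ^{d+1}` — `comp bhK KInv = resid` with a pure-gauge
defect — torus invertibility is row (T-INV); PART 2 transfers an2's RELATIVE inverses instead).  §4 `perZ_scaleK` ∕ `perF_scaleK` over `HessKerRate.scaleK` itself (site-constant
fibre scalars leave the period sum, summability-free), `perF_unitK` ∕ `perF_counitK` (`exact perF_scaleK …`).  §5 invariance plumbing (`shiftK (N•t) K = K ∀ t` and `N ∣ M_i` ⇒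
`Mℤ^{d+1}`-invariance; `KInv_translate_invariant` from `shiftK_KInv`).  §6 linearity (`perZ_add ∕ _sub` under `Decays`, `perZ_smul ∕ _neg` free; matrix forms).  PART 2
(`FP/KernelPeriodisationFibDec`): `perZ_dec` (periodisation commutes EXACTLY with the block-contour decimation), `perZ_KInvStep`, the wrap-around estimate, de-periodisation,
the `Spr` packaging and `perF_relInv`.  Moves NO (CONV-C) clause and NO row-D1 binder; NOT SDF, NOT D1, NOT BetaPertH, NOT continuum, NOT Clay.  HONEST DEPENDENCY:
continuum YM on T⁴ ⇐ BetaPertH ∧ nine spine estimates (0/9 proved); BetaPertH ⇐ (D1) ∧ (D4) ∧ CAP+tail; G-an2-4 gates asym, D1 and NE2/3/4.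
-/

noncomputable section

open scoped BigOperators Matrix
open Finset

namespace Summit.QuantumFields.BalabanUV.Beta.FP.KernelPeriodisationFib

open Literature.MathematicalPhysics.QuantumFieldTheory.Balaban1983to89
open Literature.MathematicalPhysics.QuantumFieldTheory.Balaban1983to89.Beta
open B12Sec2to5 (l1 l1_nonneg)
open B4TorusKernel.MultiPeriod (translate translate_apply)
open B4Reflection242 (translate_translate)
open B6Lemma24Torus (pbox)
open ExpKernelCalculus (MKer Decays shiftK summable_exp_shift)
open HessKerRate (scaleK scaleK_apply)
open HessKerSchurResolvent (idK idK_apply)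
open OneStepResolventKernel (Fib KInv shiftK_KInv)
open Summit.QuantumFields.BalabanUV.Beta.HessKerDressedUnits (unitK counitK legScale)
open Summit.QuantumFields.BalabanUV.Beta.GAN24.KernelPeriodisation (per per_apply per_comp per_delta per_trK sh)
open Summit.QuantumFields.BalabanUV.Beta.GAN24.DirichletExhaustionQuadForm (amb)
open Summit.QuantumFields.BalabanUV.Beta.GAN24.DirichletExhaustionCovariance (trK)
open Summit.QuantumFields.BalabanUV.Beta.GAN24.DirichletExhaustionDeltaZ (exp_l1_le_exp_dist)
open Summit.QuantumFields.BalabanUV.Beta.GAN24.DirichletExhaustionDeperiodise (summable_translate)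

variable {d : ℕ} {F : Type*}

/-! ## §1 The periodised kernel and its box restriction -/

/-- the translate `y + M∘m` written additively. -/
theorem translate_eq_add (M : Fin (d + 1) → ℕ) (y m : Fin (d + 1) → ℤ) : translate M y m = y + fun i => (M i : ℤ) * m i := by
  funext i; simp only [translate_apply, Pi.add_apply]

/-- a `Decays` bound with the constant replaced by its absolute value. -/
theorem decays_abs {K : MKer (d + 1) F} {C δ : ℝ} (hK : Decays K C δ) : Decays K (|C|) δ :=
  fun x y a b => (hK x y a b).trans (mul_le_mul_of_nonneg_right (le_abs_self C) (Real.exp_pos _).le)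

/-- a `Decays` bound in the sup-distance form centred at the first site argument (`ℓ¹ ≥ sup`). -/
theorem decays_dist_bound {K : MKer (d + 1) F} {C δ : ℝ} (hK : Decays K C δ) (hC : 0 ≤ C) (hδ : 0 ≤ δ) (x : Fin (d + 1) → ℤ)
    (a b : F) (z : Fin (d + 1) → ℤ) : |K x z a b| ≤ C * Real.exp (-(δ * dist x z)) :=
  (hK x z a b).trans (mul_le_mul_of_nonneg_left (exp_l1_le_exp_dist hδ x z) hC)

/-- the period sum of a decaying kernel along any period vector with positive components is summable. -/
theorem summable_translate_of_decays {K : MKer (d + 1) F} {C δ : ℝ} (hK : Decays K C δ) (hC : 0 ≤ C) (hδ : 0 < δ)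
    {Q : Fin (d + 1) → ℕ} (hQ : ∀ i, 1 ≤ Q i) (x y : Fin (d + 1) → ℤ) (a b : F) :
    Summable fun m : Fin (d + 1) → ℤ => K x (translate Q y m) a b :=
  summable_translate (f := fun z => K x z a b) (x₀ := x) hδ hC (decays_dist_bound hK hC hδ.le x a b) hQ y

/-- **the periodised kernel AS A KERNEL**: `perZ M K x y a b = Σ'_m K x (y + M∘m) a b`. [our object] -/
def perZ (M : Fin (d + 1) → ℕ) (K : MKer (d + 1) F) : MKer (d + 1) F := fun x y a b => ∑' m : Fin (d + 1) → ℤ, K x (translate M y m) a b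

/-- unfolding `perZ`. -/
theorem perZ_apply (M : Fin (d + 1) → ℕ) (K : MKer (d + 1) F) (x y : Fin (d + 1) → ℤ) (a b : F) :
    perZ M K x y a b = ∑' m : Fin (d + 1) → ℤ, K x (translate M y m) a b := rfl

/-- `perZ` is periodic in its second site argument (re-indexing; no convergence needed). -/
theorem perZ_translate_right (M : Fin (d + 1) → ℕ) (K : MKer (d + 1) F) (x y m₀ : Fin (d + 1) → ℤ) (a b : F) :
    perZ M K x (translate M y m₀) a b = perZ M K x y a b := by
  simp only [perZ_apply, translate_translate]
  exact (Equiv.addLeft m₀).tsum_eq fun m => K x (translate M y m) a b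

/-- for an `Mℤ^{d+1}`-INVARIANT kernel, `perZ` is invariant under simultaneous translation … -/
theorem perZ_translate_both (M : Fin (d + 1) → ℕ) {K : MKer (d + 1) F}
    (hK : ∀ (m x y : Fin (d + 1) → ℤ) (a b : F), K (translate M x m) (translate M y m) a b = K x y a b)
    (x y m₀ : Fin (d + 1) → ℤ) (a b : F) :
    perZ M K (translate M x m₀) (translate M y m₀) a b = perZ M K x y a b := by
  simp only [perZ_apply]
  refine tsum_congr fun m => ?_
  rw [translate_translate, add_comm, ← translate_translate, hK]

/-- … hence periodic in its first site argument too. -/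
theorem perZ_translate_left (M : Fin (d + 1) → ℕ) {K : MKer (d + 1) F}
    (hK : ∀ (m x y : Fin (d + 1) → ℤ) (a b : F), K (translate M x m) (translate M y m) a b = K x y a b)
    (x y m₀ : Fin (d + 1) → ℤ) (a b : F) :
    perZ M K (translate M x m₀) y a b = perZ M K x y a b := by
  rw [← perZ_translate_right M K (translate M x m₀) y m₀, perZ_translate_both M hK]

/-- index type of the periodised matrices: a box representative × a fibre component. -/
abbrev Idx (M : Fin (d + 1) → ℕ) (F : Type*) : Type _ := ↥(pbox M) × F

/-- **the periodisation map onto the matrices of the torus box**: `perF M K (r,a) (s,b) = Σ'_m K r (s + M∘m) a b`. [our object] -/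
def perF (M : Fin (d + 1) → ℕ) (K : MKer (d + 1) F) : Matrix (Idx M F) (Idx M F) ℝ :=
  Matrix.of fun p q => perZ M K (p.1 : Fin (d + 1) → ℤ) (q.1 : Fin (d + 1) → ℤ) p.2 q.2

/-- `perF` is the box restriction of `perZ`. -/
theorem perF_apply (M : Fin (d + 1) → ℕ) (K : MKer (d + 1) F) (p q : Idx M F) :
    perF M K p q = perZ M K (p.1 : Fin (d + 1) → ℤ) (q.1 : Fin (d + 1) → ℤ) p.2 q.2 := rfl

/-! ## §2 The dictionary to PART A (`GAN24/KernelPeriodisation.per`) -/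

section Dictionary

variable {n : ℕ} (e : F ≃ Fin n)

/-- currying a fibred kernel through a fibre enumeration `e : F ≃ Fin n` into PART A's kernel type on `(ℤ^{d+1}) × Fin n`. -/
def toK (K : MKer (d + 1) F) : B4Sect5Exhaustion.K (d + 1) n → B4Sect5Exhaustion.K (d + 1) n → ℝ :=
  fun p q => K p.1 q.1 (e.symm p.2) (e.symm q.2)

/-- unfolding `toK`. -/
@[simp] theorem toK_apply (K : MKer (d + 1) F) (p q : B4Sect5Exhaustion.K (d + 1) n) :
    toK e K p q = K p.1 q.1 (e.symm p.2) (e.symm q.2) := rfl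

/-- the index map `(r, a) ↦ (r, e a)` from our box × fibre indices to PART A's. -/
def idxMap (M : Fin (d + 1) → ℕ) : Idx M F ≃ B4.Idx (pbox M) n := Equiv.prodCongr (Equiv.refl _) e

/-- unfolding `idxMap`. -/
@[simp] theorem idxMap_apply (M : Fin (d + 1) → ℕ) (p : Idx M F) : idxMap e M p = (p.1, e p.2) := rfl

/-- **`perF` is PART A's `per` of the curried kernel, re-indexed along the fibre enumeration.** -/
theorem perF_eq_submatrix (M : Fin (d + 1) → ℕ) (K : MKer (d + 1) F) :
    perF M K = (per M (toK e K)).submatrix (idxMap e M) (idxMap e M) := by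
  ext p q
  simp only [Matrix.submatrix_apply, perF_apply, perZ_apply, per_apply, idxMap_apply, toK_apply, sh, amb, Equiv.symm_apply_apply]

/-- the transposed∕fibre-swapped kernel. -/
def trF (K : MKer (d + 1) F) : MKer (d + 1) F := fun x y a b => K y x b a

/-- `toK` of the transposed kernel is PART A's `trK`. -/
theorem toK_trF (K : MKer (d + 1) F) : toK e (trF K) = trK (toK e K) := rfl

/-- a `Decays` bound (in `ℓ¹`) is PART A's sup-distance bound for the curried kernel. -/
theorem toK_bound {K : MKer (d + 1) F} {C δ : ℝ} (hK : Decays K C δ) (hC : 0 ≤ C) (hδ : 0 ≤ δ)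
    (p q : B4Sect5Exhaustion.K (d + 1) n) : |toK e K p q| ≤ C * Real.exp (-(δ * dist p.1 q.1)) :=
  decays_dist_bound hK hC hδ p.1 _ _ q.1

/-- `Mℤ^{d+1}`-invariance transfers to the curried kernel. -/
theorem toK_invariant (M : Fin (d + 1) → ℕ) {K : MKer (d + 1) F}
    (hK : ∀ (m x y : Fin (d + 1) → ℤ) (a b : F), K (translate M x m) (translate M y m) a b = K x y a b)
    (m : Fin (d + 1) → ℤ) (p q : B4Sect5Exhaustion.K (d + 1) n) : toK e K (sh M m p) (sh M m q) = toK e K p q := by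
  simp only [toK_apply, sh]
  exact hK m p.1 q.1 _ _

/-- a decaying kernel is bounded by its constant (`δ ≥ 0`). -/
theorem abs_le_of_decays {K : MKer (d + 1) F} {C δ : ℝ} (hK : Decays K C δ) (hC : 0 ≤ C) (hδ : 0 ≤ δ)
    (x y : Fin (d + 1) → ℤ) (a b : F) : |K x y a b| ≤ C := by
  refine (hK x y a b).trans ?_
  have : Real.exp (-δ * l1 (x - y)) ≤ 1 := Real.exp_le_one_iff.2 (by nlinarith [l1_nonneg (x - y)])
  nlinarith

/-- the product family `(y, g) ↦ A x y a (e⁻¹ g) · B y z (e⁻¹ g) b` is summable on `sites × Fin n` (decay of `A`, boundedness of `B`). -/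
theorem summable_compFamily {A B : MKer (d + 1) F} {CA CB α β : ℝ} (hA : Decays A CA α) (hB : Decays B CB β) (hα : 0 < α)
    (hβ : 0 ≤ β) (hCA : 0 ≤ CA) (hCB : 0 ≤ CB) (x z : Fin (d + 1) → ℤ) (a b : F) :
    Summable fun r : B4Sect5Exhaustion.K (d + 1) n => A x r.1 a (e.symm r.2) * B r.1 z (e.symm r.2) b := by
  have hg : Summable fun r : B4Sect5Exhaustion.K (d + 1) n => |A x r.1 a (e.symm r.2) * B r.1 z (e.symm r.2) b| := by
    refine (summable_prod_of_nonneg fun r => abs_nonneg _).2 ⟨fun y => ?_, ?_⟩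
    · exact (hasSum_fintype _).summable
    · simp only [tsum_fintype]
      refine summable_sum fun g _ => ?_
      refine ((summable_exp_shift hα x).mul_left (CA * CB)).of_nonneg_of_le (fun y => abs_nonneg _) fun y => ?_
      rw [abs_mul]
      calc |A x y a (e.symm g)| * |B y z (e.symm g) b| ≤ (CA * Real.exp (-α * l1 (x - y))) * CB :=
            mul_le_mul (hA x y a _) (abs_le_of_decays hB hCB hβ y z _ b) (abs_nonneg _) (by positivity)
        _ = CA * CB * Real.exp (-α * l1 (x - y)) := by ring
  exact hg.of_abs

variable [Fintype F]

/-- **`toK` is multiplicative**: the road's composition `ExpKernelCalculus.comp` (site sum with the fibre sum inside) is PART A's `comp`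
(one sum over `sites × Fin n`) after currying. -/
theorem toK_comp {A B : MKer (d + 1) F} {CA CB α β : ℝ} (hA : Decays A CA α) (hB : Decays B CB β) (hα : 0 < α) (hβ : 0 ≤ β)
    (hCA : 0 ≤ CA) (hCB : 0 ≤ CB) :
    toK e (ExpKernelCalculus.comp A B) = Summit.QuantumFields.BalabanUV.Beta.GAN24.KernelPeriodisation.comp (toK e A) (toK e B) := by
  funext p q
  simp only [toK_apply, ExpKernelCalculus.comp, Summit.QuantumFields.BalabanUV.Beta.GAN24.KernelPeriodisation.comp]
  rw [(summable_compFamily e hA hB hα hβ hCA hCB p.1 q.1 (e.symm p.2) (e.symm q.2)).tsum_prod]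
  refine tsum_congr fun y => ?_
  rw [tsum_fintype]
  exact (e.symm.sum_comp fun f => A p.1 y (e.symm p.2) f * B y q.1 f (e.symm q.2)).symm

end Dictionary

/-! ## §3 Periodisation is an algebra homomorphism on invariant kernels -/

section Hom

variable [Fintype F] (M : Fin (d + 1) → ℕ) [∀ μ, NeZero (M μ)]

/-- **`perF_comp` — PERIODISATION OF FIBRED KERNELS IS MULTIPLICATIVE**: for decaying `A, B` with `B` invariant under the diagonal action of
the period lattice, `perF M (A ∘ B) = perF M A * perF M B` (PART A's `per_comp` through the dictionary). [folklore] -/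
theorem perF_comp {A B : MKer (d + 1) F} {CA CB α β : ℝ} (hA : Decays A CA α) (hB : Decays B CB β) (hα : 0 < α) (hβ : 0 < β)
    (hBinv : ∀ (m x y : Fin (d + 1) → ℤ) (a b : F), B (translate M x m) (translate M y m) a b = B x y a b) :
    perF M (ExpKernelCalculus.comp A B) = perF M A * perF M B := by
  rcases isEmpty_or_nonempty F with hF | ⟨⟨a₀⟩⟩
  · ext p q; exact (IsEmpty.false p.2).elim
  · have hCA : 0 ≤ CA := hA.nonneg a₀
    have hCB : 0 ≤ CB := hB.nonneg a₀
    set e := Fintype.equivFin F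
    rw [perF_eq_submatrix e, perF_eq_submatrix e, perF_eq_submatrix e, toK_comp e hA hB hα hβ.le hCA hCB,
      per_comp M hα hβ hCA hCB (toK_bound e hA hCA hα.le) (toK_bound e hB hCB hβ.le) (toK_invariant e M hBinv),
      Matrix.submatrix_mul_equiv]

variable [DecidableEq F]

omit [Fintype F] [∀ μ, NeZero (M μ)] in
/-- `toK` of the Kronecker kernel is PART A's Kronecker kernel. -/
theorem toK_idK {n : ℕ} (e : F ≃ Fin n) :
    toK e (idK : MKer (d + 1) F) = fun p q => if p = q then (1 : ℝ) else 0 := by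
  funext p q
  simp only [toK_apply, idK_apply, Equiv.apply_eq_iff_eq e.symm, Prod.ext_iff]

/-- **`perF M idK = 1`**: the periodised Kronecker kernel is the identity matrix of the box. -/
theorem perF_idK : perF M (idK : MKer (d + 1) F) = 1 := by
  rw [perF_eq_submatrix (Fintype.equivFin F), toK_idK, per_delta, Matrix.submatrix_one_equiv]

omit [∀ μ, NeZero (M μ)] [DecidableEq F] in
/-- **periodisation intertwines the transpose** (for an invariant kernel; re-indexing only). -/
theorem perF_transpose {K : MKer (d + 1) F}
    (hK : ∀ (m x y : Fin (d + 1) → ℤ) (a b : F), K (translate M x m) (translate M y m) a b = K x y a b) :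
    perF M (trF K) = (perF M K)ᵀ := by
  ext p q
  set e := Fintype.equivFin F
  rw [perF_eq_submatrix e, perF_eq_submatrix e, Matrix.transpose_apply, Matrix.submatrix_apply, Matrix.submatrix_apply, toK_trF,
    per_trK M (toK_invariant e M hK)]

end Hom

/-! ## §4 Diagonal fibre scalings (the wall's units map) -/

section Scale

variable (M : Fin (d + 1) → ℕ)

/-- `perZ` of a fibre-rescaled kernel, entrywise: the (site-constant) scalars leave the period sum — no summability, no non-vanishing. -/
theorem perZ_scaleK_apply (u v : F → ℝ) (K : MKer (d + 1) F) (x y : Fin (d + 1) → ℤ) (a b : F) :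
    perZ M (scaleK u v K) x y a b = u a * perZ M K x y a b * v b := by
  simp only [perZ_apply, scaleK_apply]
  rw [tsum_mul_right, tsum_mul_left]

/-- **`perZ M (u K v) = u (perZ M K) v`** as kernels. -/
theorem perZ_scaleK (u v : F → ℝ) (K : MKer (d + 1) F) : perZ M (scaleK u v K) = scaleK u v (perZ M K) := by
  funext x y a b; exact perZ_scaleK_apply M u v K x y a b

/-- entries of `perF` of a fibre-rescaled kernel. -/
theorem perF_scaleK_apply (u v : F → ℝ) (K : MKer (d + 1) F) (p q : Idx M F) :
    perF M (scaleK u v K) p q = u p.2 * perF M K p q * v q.2 :=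
  perZ_scaleK_apply M u v K _ _ _ _

variable [Fintype F] [DecidableEq F]

/-- **`perF` of a fibre-rescaled kernel is the diagonally rescaled matrix**: `perF M (u K v) = diag(u) * perF M K * diag(v)`. -/
theorem perF_scaleK (u v : F → ℝ) (K : MKer (d + 1) F) :
    perF M (scaleK u v K) =
      Matrix.diagonal (fun p : Idx M F => u p.2) * perF M K * Matrix.diagonal (fun q : Idx M F => v q.2) := by
  ext p q
  rw [Matrix.mul_diagonal, Matrix.diagonal_mul, perF_scaleK_apply]

/-- **the wall's units map commutes with periodisation**: `perF M (unitK sf sm K) = D * perF M K * D`, `D = diag(legScale sf sm)`. -/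
theorem perF_unitK (sf sm : ℝ) (K : MKer (d + 1) (Fib d)) :
    perF M (unitK sf sm K) =
      Matrix.diagonal (fun p : Idx M (Fib d) => legScale (d := d) sf sm p.2) * perF M K *
        Matrix.diagonal (fun q : Idx M (Fib d) => legScale (d := d) sf sm q.2) :=
  perF_scaleK M _ _ K

/-- … and so does the co-units map `counitK` (`= scaleK (legScale sf⁻¹ sm⁻¹) (legScale sf⁻¹ sm⁻¹)`). -/
theorem perF_counitK (sf sm : ℝ) (K : MKer (d + 1) (Fib d)) :
    perF M (counitK sf sm K) =
      Matrix.diagonal (fun p : Idx M (Fib d) => legScale (d := d) sf⁻¹ sm⁻¹ p.2) * perF M K *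
        Matrix.diagonal (fun q : Idx M (Fib d) => legScale (d := d) sf⁻¹ sm⁻¹ q.2) :=
  perF_scaleK M _ _ K

end Scale

/-! ## §5 Invariance plumbing: block-translation covariance ⇒ period-lattice invariance -/

section Invariance

variable (M : Fin (d + 1) → ℕ)

/-- **block-translation covariance at blocking `N` gives invariance under every period lattice `Mℤ^{d+1}` with `N ∣ M_i`.** -/
theorem translate_invariant_of_shiftK {N : ℕ} {K : MKer (d + 1) F} (hK : ∀ t : Fin (d + 1) → ℤ, shiftK ((N : ℤ) • t) K = K)
    (hM : ∀ i, N ∣ M i) (m x y : Fin (d + 1) → ℤ) (a b : F) : K (translate M x m) (translate M y m) a b = K x y a b := by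
  choose c hc using hM
  have hv : (fun i => (M i : ℤ) * m i) = (N : ℤ) • fun i => (c i : ℤ) * m i := by
    funext i; simp only [Pi.smul_apply, smul_eq_mul, hc i, Nat.cast_mul]; ring
  have h := hK (fun i => (c i : ℤ) * m i)
  rw [translate_eq_add, translate_eq_add, hv]
  exact congrFun (congrFun (congrFun (congrFun h x) y) a) b

/-- **the packed resolvent `KInv N` is `Mℤ^{d+1}`-invariant whenever `N ∣ M_i`** (`OneStepResolventKernel.shiftK_KInv`). -/
theorem KInv_translate_invariant {N : ℕ} [NeZero N] (hM : ∀ i, N ∣ M i) (m x y : Fin (d + 1) → ℤ) (a b : Fib d) :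
    KInv (N := N) (d := d) (translate M x m) (translate M y m) a b = KInv (N := N) (d := d) x y a b := by
  refine translate_invariant_of_shiftK M (fun t => ?_) hM m x y a b
  have h := shiftK_KInv (N := N) (d := d) (-t)
  rwa [smul_neg, neg_neg] at h

end Invariance

/-! ## §6 Linearity of the periodisation (sums need summability; scalars and negation do not) -/

section Linear

variable (M : Fin (d + 1) → ℕ)

/-- `perZ M (c • K) = c • perZ M K` (no summability needed). -/
theorem perZ_smul (c : ℝ) (K : MKer (d + 1) F) : perZ M (c • K) = c • perZ M K := by
  funext x y a b
  simp only [perZ_apply, Pi.smul_apply, smul_eq_mul]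
  exact tsum_mul_left

/-- `perZ M (−K) = −perZ M K` (no summability needed). -/
theorem perZ_neg (K : MKer (d + 1) F) : perZ M (-K) = -perZ M K := by
  funext x y a b
  simp only [perZ_apply, Pi.neg_apply]
  exact tsum_neg

variable [∀ μ, NeZero (M μ)]

/-- `perZ M (A + B) = perZ M A + perZ M B` for decaying `A`, `B`. -/
theorem perZ_add {A B : MKer (d + 1) F} {CA CB α β : ℝ} (hA : Decays A CA α) (hB : Decays B CB β) (hα : 0 < α) (hβ : 0 < β) :
    perZ M (A + B) = perZ M A + perZ M B := by
  have hM : ∀ i, 1 ≤ M i := fun i => Nat.one_le_iff_ne_zero.2 (NeZero.ne _)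
  funext x y a b
  simp only [perZ_apply, Pi.add_apply]
  exact (summable_translate_of_decays (decays_abs hA) (abs_nonneg _) hα hM x y a b).tsum_add
    (summable_translate_of_decays (decays_abs hB) (abs_nonneg _) hβ hM x y a b)

/-- `perZ M (A − B) = perZ M A − perZ M B` for decaying `A`, `B`. -/
theorem perZ_sub {A B : MKer (d + 1) F} {CA CB α β : ℝ} (hA : Decays A CA α) (hB : Decays B CB β) (hα : 0 < α) (hβ : 0 < β) :
    perZ M (A - B) = perZ M A - perZ M B := by
  have hnB : Decays (-B) (|CB|) β := fun x y a b => by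
    rw [Pi.neg_apply, Pi.neg_apply, Pi.neg_apply, Pi.neg_apply, abs_neg]; exact decays_abs hB x y a b
  rw [sub_eq_add_neg, perZ_add M hA hnB hα hβ, perZ_neg, ← sub_eq_add_neg]

/-- the matrix forms. -/
theorem perF_add {A B : MKer (d + 1) F} {CA CB α β : ℝ} (hA : Decays A CA α) (hB : Decays B CB β) (hα : 0 < α) (hβ : 0 < β) :
    perF M (A + B) = perF M A + perF M B := by
  ext p q; simp only [perF_apply, Matrix.add_apply, perZ_add M hA hB hα hβ, Pi.add_apply]

/-- … -/
theorem perF_sub {A B : MKer (d + 1) F} {CA CB α β : ℝ} (hA : Decays A CA α) (hB : Decays B CB β) (hα : 0 < α) (hβ : 0 < β) :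
    perF M (A - B) = perF M A - perF M B := by
  ext p q; simp only [perF_apply, Matrix.sub_apply, perZ_sub M hA hB hα hβ, Pi.sub_apply]

omit [∀ μ, NeZero (M μ)] in
/-- … -/
theorem perF_smul (c : ℝ) (K : MKer (d + 1) F) : perF M (c • K) = c • perF M K := by
  ext p q; simp only [perF_apply, Matrix.smul_apply, perZ_smul, Pi.smul_apply]

end Linear

end Summit.QuantumFields.BalabanUV.Beta.FP.KernelPeriodisationFib

end
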